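import Summits.CriticalPhenomena.Ising3DConformalLimit.Theses.FKParityRobustness
import Summits.CriticalPhenomena.Ising3DConformalLimit.Theorems.FKParityRobustnessDefs
import Literature.Combinatorics.SimpleGraph.CycleSpaceSeparators
import HarnessLib

/-!
# `IndependentStrandsJoin` (item stmt-CriticalPhenomena-14625): load-bearing analysis

Negative-side knowledge about the crux
`Summit.CriticalPhenomena.Ising3DConformalLimit.Theses.FKParityRobustness.IndependentStrandsJoin`
(standing crux disprover, cycle 1, D-0016); theorem-only file, every variant statement is the crux
verbatim with one quantifier changed:

* `independentStrandsJoin_withoutHl` — the hypothesis `1 ≤ l` is NOT load-bearing: the crux implies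
  its own variant with `1 ≤ l` deleted, because the `l = 0` instance is degenerate-true (the four sources
  coincide at the origin, `{a₀,a₁} = {a₀}`, and no `T`-join has a single source — handshake lemma,
  `tJoins_singleton_eq_empty` — so both sides vanish, `inner_holds_at_l_zero`).  The hypothesis enters a
  proof only through the injectivity of the source map.
* `independentStrandsJoin_withoutHc_holds` — with `0 < c` deleted the crux is trivially TRUE (`c = 0`):
  the whole content is the positivity of one constant.
* `independentStrandsJoin_perScale` — the crux implies its PER-SCALE form (`∀ l, ∃ c(l) > 0, …`); the
  per-scale form is true on paper with `c(l) = (t_c/(1+t_c))^{8l}` (crux work file `Disproof.lean`, § A), so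
  the content of the crux is exactly the UNIFORMITY of the constant in the scale `l`.
* `reachable_cross_iff_allJoined` — for `F₁ ∈ 𝒯(a₀a₁)`, `F₂ ∈ 𝒯(a₂a₃)` the crux's event `a₀ ↔ a₂ in
  F₁ ∪ F₂` is equivalent to "all four sources in one component" (each `T`-join joins its own pair,
  `reachable_of_mem_tJoins_pair`): the mutation "all joined" is not a strengthening.
* `jointSum_le_mul` — the right-hand side never exceeds `Z(a₀a₁)·Z(a₂a₃)`: admissible constants are `≤ 1`.
-/

noncomputable section

namespace Summit.CriticalPhenomena.Ising3DConformalLimit.IndependentStrandsJoinNegative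

open Finset
open Literature.Probability.LatticeModels
open Literature.Combinatorics.SimpleGraph.CycleSpace
open Summit.CriticalPhenomena.Ising3DConformalLimit.Cruxes.ParityRobustMerging.PlaquetteXorSurgery
  (tetra tanh_criticalBeta_nonneg)
open Summit.CriticalPhenomena.Ising3DConformalLimit.Theses.FKParityRobustness (IndependentStrandsJoin)
open scoped Classical

section General

variable {V : Type*} [Fintype V] [DecidableEq V] (G : SimpleGraph V) [DecidableRel G.Adj]

/-- **Tightness of the constant**: dropping the indicator,
`Σ_{F₁} Σ_{F₂} t^{|F₁|+|F₂|} 1[…] ≤ Z(a₀a₁)·Z(a₂a₃)` for `t ≥ 0`. [folklore] -/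
theorem jointSum_le_mul {t : ℝ} (ht : 0 ≤ t) (a : Fin 4 → V) :
    (∑ F₁ ∈ tJoins G Set.univ {a 0, a 1}, ∑ F₂ ∈ tJoins G Set.univ {a 2, a 3},
      if (SimpleGraph.fromEdgeSet ((↑F₁ : Set (Sym2 V)) ∪ ↑F₂)).Reachable (a 0) (a 2)
        then t ^ (#F₁ + #F₂) else (0 : ℝ)) ≤
    loopO1PartitionFunction G t {a 0, a 1} * loopO1PartitionFunction G t {a 2, a 3} := by
  have hZ : ∀ A : Finset V, loopO1PartitionFunction G t A = ∑ F ∈ tJoins G Set.univ A, t ^ #F := by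
    intro A
    unfold loopO1PartitionFunction loopO1Weight
    rw [← Finset.sum_filter]
    refine Finset.sum_congr ?_ fun _ _ => rfl
    ext F
    simp only [Finset.mem_filter, Finset.mem_powerset]
    exact ⟨fun h => h.2, fun h => ⟨((mem_tJoins G).1 h).1, h⟩⟩
  rw [hZ, hZ, Finset.sum_mul_sum]
  refine Finset.sum_le_sum fun F₁ _ => Finset.sum_le_sum fun F₂ _ => ?_
  split_ifs
  · rw [pow_add]
  · positivity

/-- **Handshake**: no `T`-join has a single source (`tJoins G ω {x} = ∅`). [folklore] -/
theorem tJoins_singleton_eq_empty (ω : Set (Sym2 V)) (x : V) : tJoins G ω {x} = ∅ := by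
  refine Finset.eq_empty_iff_forall_notMem.2 fun F hF => ?_
  obtain ⟨hFG, -, hpar⟩ := (mem_tJoins G).1 hF
  have hFE : ∀ e ∈ F, ¬ e.IsDiag := fun e he =>
    SimpleGraph.not_isDiag_of_mem_edgeSet G (SimpleGraph.mem_edgeFinset.1 (hFG he))
  have hx : Odd (edgeDeg F x) := (hpar x).2 (Finset.mem_singleton_self x)
  obtain ⟨w, hw, -, hwodd⟩ := exists_reachable_odd_of_odd F hFE hx
  exact hw (Finset.mem_singleton.1 ((hpar w).1 hwodd))

/-- Hence `Z^{{x}}_t(G) = 0`: coincident sources kill the partition function. [folklore] -/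
theorem loopO1PartitionFunction_singleton (t : ℝ) (x : V) : loopO1PartitionFunction G t {x} = 0 := by
  unfold loopO1PartitionFunction loopO1Weight
  exact Finset.sum_eq_zero fun F _ => by rw [tJoins_singleton_eq_empty]; simp

/-- **A `T`-join of a pair joins the pair**: if `∂F = {x, y}` then `x ↔ y` inside `F` (handshake in the
component of `x`). [folklore] -/
theorem reachable_of_mem_tJoins_pair {ω : Set (Sym2 V)} {x y : V} {F : Finset (Sym2 V)}
    (hF : F ∈ tJoins G ω {x, y}) : (SimpleGraph.fromEdgeSet (↑F : Set (Sym2 V))).Reachable x y := by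
  by_cases hxy : x = y
  · subst hxy; exact SimpleGraph.Reachable.refl _
  obtain ⟨hFG, -, hpar⟩ := (mem_tJoins G).1 hF
  have hFE : ∀ e ∈ F, ¬ e.IsDiag := fun e he =>
    SimpleGraph.not_isDiag_of_mem_edgeSet G (SimpleGraph.mem_edgeFinset.1 (hFG he))
  have hx : Odd (edgeDeg F x) := (hpar x).2 (by simp)
  obtain ⟨w, hw, hreach, hwodd⟩ := exists_reachable_odd_of_odd F hFE hx
  have hw' : w ∈ ({x, y} : Finset V) := (hpar w).1 hwodd
  rw [Finset.mem_insert, Finset.mem_singleton] at hw'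
  rcases hw' with rfl | rfl
  · exact absurd rfl hw
  · exact hreach

/-- **The crux's event is "all four joined".**  For `F₁ ∈ 𝒯(a₀a₁)`, `F₂ ∈ 𝒯(a₂a₃)`:
`a₀ ↔ a₂ in F₁ ∪ F₂` iff every `aᵢ ↔ aⱼ in F₁ ∪ F₂`. [folklore] -/
theorem reachable_cross_iff_allJoined {ω : Set (Sym2 V)} (a : Fin 4 → V) {F₁ F₂ : Finset (Sym2 V)}
    (h₁ : F₁ ∈ tJoins G ω {a 0, a 1}) (h₂ : F₂ ∈ tJoins G ω {a 2, a 3}) :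
    (SimpleGraph.fromEdgeSet ((↑F₁ : Set (Sym2 V)) ∪ ↑F₂)).Reachable (a 0) (a 2) ↔
      ∀ i j, (SimpleGraph.fromEdgeSet ((↑F₁ : Set (Sym2 V)) ∪ ↑F₂)).Reachable (a i) (a j) := by
  set H := SimpleGraph.fromEdgeSet ((↑F₁ : Set (Sym2 V)) ∪ ↑F₂) with hH
  have h01 : H.Reachable (a 0) (a 1) :=
    (reachable_of_mem_tJoins_pair G h₁).mono (SimpleGraph.fromEdgeSet_mono Set.subset_union_left)
  have h23 : H.Reachable (a 2) (a 3) :=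
    (reachable_of_mem_tJoins_pair G h₂).mono (SimpleGraph.fromEdgeSet_mono Set.subset_union_right)
  refine ⟨fun h02 => ?_, fun h => h 0 2⟩
  have h0 : ∀ i, H.Reachable (a 0) (a i) := by
    intro i
    fin_cases i
    · exact SimpleGraph.Reachable.refl _
    · exact h01
    · exact h02
    · exact h02.trans h23
  exact fun i j => (h0 i).symm.trans (h0 j)

end General

/-! ### The box setting of the crux -/

/-- The inner double sum of the crux is nonnegative (`t_c = tanh β_c ≥ 0`). [folklore] -/
theorem innerSum_nonneg {N : ℕ} (a : Fin 4 → ↥(box 3 N)) :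
    0 ≤ ∑ F₁ ∈ tJoins ((zdGraph 3).comap (Subtype.val : ↥(box 3 N) → Site 3)) Set.univ {a 0, a 1},
      ∑ F₂ ∈ tJoins ((zdGraph 3).comap (Subtype.val : ↥(box 3 N) → Site 3)) Set.univ {a 2, a 3},
        if (SimpleGraph.fromEdgeSet ((↑F₁ : Set (Sym2 ↥(box 3 N))) ∪ ↑F₂)).Reachable (a 0) (a 2)
          then Real.tanh (criticalBeta 3) ^ (F₁.card + F₂.card) else (0 : ℝ) := by
  refine Finset.sum_nonneg fun F₁ _ => Finset.sum_nonneg fun F₂ _ => ?_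
  split_ifs
  · exact pow_nonneg tanh_criticalBeta_nonneg _
  · exact le_rfl

/-- At `l = 0` the inner inequality of the crux holds for EVERY real `c`: the sources coincide,
`{a₀, a₁} = {a₀}` and `Z({a₀}) = 0` (`loopO1PartitionFunction_singleton`). [folklore] -/
theorem inner_holds_at_l_zero (c : ℝ) {N : ℕ} (a : Fin 4 → ↥(box 3 N))
    (ha : ∀ i, ((a i : Site 3)) = ((0 : ℕ) : ℤ) • tetra i) :
    c * loopO1PartitionFunction ((zdGraph 3).comap (Subtype.val : ↥(box 3 N) → Site 3))
        (Real.tanh (criticalBeta 3)) {a 0, a 1} *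
      loopO1PartitionFunction ((zdGraph 3).comap (Subtype.val : ↥(box 3 N) → Site 3))
        (Real.tanh (criticalBeta 3)) {a 2, a 3} ≤
    ∑ F₁ ∈ tJoins ((zdGraph 3).comap (Subtype.val : ↥(box 3 N) → Site 3)) Set.univ {a 0, a 1},
      ∑ F₂ ∈ tJoins ((zdGraph 3).comap (Subtype.val : ↥(box 3 N) → Site 3)) Set.univ {a 2, a 3},
        if (SimpleGraph.fromEdgeSet ((↑F₁ : Set (Sym2 ↥(box 3 N))) ∪ ↑F₂)).Reachable (a 0) (a 2)
          then Real.tanh (criticalBeta 3) ^ (F₁.card + F₂.card) else (0 : ℝ) := by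
  have h01 : a 0 = a 1 := Subtype.ext (by rw [ha 0, ha 1]; simp)
  have hpair : ({a 0, a 1} : Finset ↥(box 3 N)) = {a 0} := by rw [← h01]; simp
  rw [hpair, loopO1PartitionFunction_singleton, mul_zero, zero_mul]
  rw [← hpair]
  exact innerSum_nonneg a

/-- **`1 ≤ l` is NOT load-bearing.**  The crux implies its own variant with the hypothesis `1 ≤ l`
deleted (everything else verbatim): the extra instance `l = 0` is degenerate-true
(`inner_holds_at_l_zero`).  The converse implication is trivial, so the two statements are equivalent;
a proof of the crux uses `1 ≤ l` only to make the source map injective. [folklore] -/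
theorem independentStrandsJoin_withoutHl (h : IndependentStrandsJoin) :
    let tetra : Fin 4 → Literature.Probability.LatticeModels.Site 3 := ![![-1, -1, -1], ![1, 1, -1], ![1, -1, 1], ![-1, 1, 1]]; ∃ c : ℝ, 0 < c ∧ ∀ l : ℕ, ∃ N₀ : ℕ, ∀ N : ℕ, N₀ ≤ N → ∀ a : Fin 4 → ↥(Literature.Probability.LatticeModels.box 3 N), (∀ i, ((a i : Literature.Probability.LatticeModels.Site 3)) = (l : ℤ) • tetra i) → (let G := ((Literature.Probability.LatticeModels.zdGraph 3).comap (Subtype.val : ↥(Literature.Probability.LatticeModels.box 3 N) → Literature.Probability.LatticeModels.Site 3)); let t : ℝ := Real.tanh (Literature.Probability.LatticeModels.criticalBeta 3); c * Literature.Probability.LatticeModels.loopO1PartitionFunction G t {a 0, a 1} * Literature.Probability.LatticeModels.loopO1PartitionFunction G t {a 2, a 3} ≤ ∑ F₁ ∈ Literature.Probability.LatticeModels.tJoins G Set.univ {a 0, a 1}, ∑ F₂ ∈ Literature.Probability.LatticeModels.tJoins G Set.univ {a 2, a 3}, if (SimpleGraph.fromEdgeSet ((↑F₁ : Set (Sym2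 ↥(Literature.Probability.LatticeModels.box 3 N))) ∪ ↑F₂)).Reachable (a 0) (a 2) then t ^ (F₁.card + F₂.card) else 0) := by
  obtain ⟨c, hc, h⟩ := h
  refine ⟨c, hc, fun l => ?_⟩
  rcases Nat.eq_zero_or_pos l with rfl | hl
  · exact ⟨0, fun N _ a ha => inner_holds_at_l_zero c a ha⟩
  · exact h l hl

/-- **`0 < c` carries all the content**: with `0 < c` deleted (everything else verbatim) the crux holds
with `c = 0`. [folklore] -/
theorem independentStrandsJoin_withoutHc_holds :
    let tetra : Fin 4 → Literature.Probability.LatticeModels.Site 3 := ![![-1, -1, -1], ![1, 1, -1], ![1, -1, 1], ![-1, 1, 1]]; ∃ c : ℝ, ∀ l : ℕ, 1 ≤ l → ∃ N₀ : ℕ, ∀ N : ℕ, N₀ ≤ N → ∀ a : Fin 4 → ↥(Literature.Probability.LatticeModels.box 3 N), (∀ i, ((a i : Literature.Probability.LatticeModels.Site 3)) = (l : ℤ) • tetra i) → (let G := ((Literature.Probability.LatticeModels.zdGraph 3).comap (Subtype.val : ↥(Literature.Probability.LatticeModels.box 3 N) → Literature.Probability.LatticeModels.Site 3)); let t : ℝ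 := Real.tanh (Literature.Probability.LatticeModels.criticalBeta 3); c * Literature.Probability.LatticeModels.loopO1PartitionFunction G t {a 0, a 1} * Literature.Probability.LatticeModels.loopO1PartitionFunction G t {a 2, a 3} ≤ ∑ F₁ ∈ Literature.Probability.LatticeModels.tJoins G Set.univ {a 0, a 1}, ∑ F₂ ∈ Literature.Probability.LatticeModels.tJoins G Set.univ {a 2, a 3}, if (SimpleGraph.fromEdgeSet ((↑F₁ : Set (Sym2 ↥(Literature.Probability.LatticeModels.box 3 N))) ∪ ↑F₂)).Reachable (a 0) (a 2) then t ^ (F₁.card + F₂.card) else 0) := by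
  refine ⟨0, fun l _ => ⟨0, fun N _ a _ => ?_⟩⟩
  simp only [zero_mul]
  exact innerSum_nonneg a

/-- **The crux implies its per-scale form** (`∀ l, ∃ c(l) > 0, …`, everything else verbatim).  The
per-scale form is TRUE (paper proof, `c(l) = (t_c/(1+t_c))^{8l}`, crux work file § A); the converse of
this implication — uniformity of the constant in `l` — is exactly the open content of the crux. [folklore] -/
theorem independentStrandsJoin_perScale (h : IndependentStrandsJoin) :
    let tetra : Fin 4 → Literature.Probability.LatticeModels.Site 3 := ![![-1, -1, -1], ![1, 1, -1], ![1, -1, 1], ![-1, 1, 1]]; ∀ l : ℕ, 1 ≤ l → ∃ c : ℝ, 0 < c ∧ ∃ N₀ : ℕ, ∀ N : ℕ, N₀ ≤ N → ∀ a : Fin 4 → ↥(Literature.Probability.LatticeModels.box 3 N), (∀ i, ((a i : Literature.Probability.LatticeModels.Site 3)) = (l : ℤ) • tetra i) → (let G := ((Literature.Probability.LatticeModels.zdGraph 3).comap (Subtype.val : ↥(Literature.Probability.LatticeModels.box 3 N) → Literature.Probability.LatticeModels.Site 3)); let t : ℝ := Real.tanh (Literature.Probability.LatticeModels.criticalBeta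 3); c * Literature.Probability.LatticeModels.loopO1PartitionFunction G t {a 0, a 1} * Literature.Probability.LatticeModels.loopO1PartitionFunction G t {a 2, a 3} ≤ ∑ F₁ ∈ Literature.Probability.LatticeModels.tJoins G Set.univ {a 0, a 1}, ∑ F₂ ∈ Literature.Probability.LatticeModels.tJoins G Set.univ {a 2, a 3}, if (SimpleGraph.fromEdgeSet ((↑F₁ : Set (Sym2 ↥(Literature.Probability.LatticeModels.box 3 N))) ∪ ↑F₂)).Reachable (a 0) (a 2) then t ^ (F₁.card + F₂.card) else 0) := by
  obtain ⟨c, hc, h⟩ := h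
  intro tetra' l hl
  exact ⟨c, hc, h l hl⟩

end Summit.CriticalPhenomena.Ising3DConformalLimit.IndependentStrandsJoinNegative

end
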